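import Literature.NumberTheory.GelbartRogawski1991.UnitaryDualPairWeilCoinvariants
import Literature.NumberTheory.Weil1964.AdelicMetaplecticScalarTwist
import Literature.NumberTheory.GelbartRogawski1991.CompatibleSplittingTwist
import HarnessLib

-- buildfix G11b-3 recipe (LEDGER B13-1/B13-3): elaborate sequentially so the trailing `attribute [implicit_reducible]`
-- block (reducibilityCoreExt is keyed to the async environment branch) is in force at `.olean` export.
set_option Elab.async false

/-!
# Central twists of a compatible pair splitting and the Weil coinvariants

[GelbartRogawski1991, §3.1, Remark p. 457]: the compatible splittings `U(J_V)(𝔸) ×' U(J_W)(𝔸) → Mp_ψ(𝕎_𝔸)` form a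
torsor under the automorphic characters `ĉ` of `G₁(𝔸_F) = U(J_V ⊗ J_W)(𝔸_F)` («every compatible splitting is
`s ⊗ ν′`»).  For the finite Weil representation `finPairRep` and its `χ`-coinvariants `weilCoinv` of
`UnitaryDualPairWeilCoinvariants.lean` this file records the effect of such a twist `s ↦ s ⊗ ĉ`
(`adelicMpCont.twist s ĉ`):

* `twistCharV ĉ k = ĉ((1,k) ⊗ 1)`, `twistCharW ĉ u = ĉ(1 ⊗ (1,u))` — the finite member characters of `ĉ`;
* `isCompatible_twist` — a twist by a character trivial on `G₁(F)` keeps compatibility (the tree's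
  `SplittingDatum.IsCompatible.of_central_twist`);
* `pairSplitting_twist_apply`, `pairRep_twist_apply`, `omega_pairSmall₁_twist_apply` — `ω ∘ (s ⊗ ĉ)_pair = ĉ_pair • ω ∘ s_pair`;
* **`finPairRep_twist`**: `ω_f^{s ⊗ ĉ}(k, u) = (twistCharV ĉ k · twistCharW ĉ u) • ω_f^{s}(k, u)` (from `finRepMp_unique`
  and the `arch ⊗ fin` factorisation), `finPairRepV_twist`, `finPairRepW_twist`;
* hence **`ker_weilCoinv_twist`**: for `χ' = twistCharW ĉ · χ` the relation submodules agree, the identification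
  **`weilCoinvTwistEquiv hs hs' hχ : Coinv (finPairRepW hs') χ' ≃ₗ[ℂ] Coinv (finPairRepW hs) χ`** (`mk ↦ mk`) and its
  intertwining law **`weilCoinvTwistEquiv_weilCoinv`**: `E ∘ Ω(s ⊗ ĉ, χ')(k) = ĉ((1,k) ⊗ 1) • Ω(s, χ)(k) ∘ E`, i.e.
  `Ω(s ⊗ ĉ, twistCharW ĉ · χ) ≅ twist (twistCharV ĉ) (Ω(s, χ))` (`weilCoinvTwistEquiv_weilCoinv_eq_twist`, in the
  currency of `Literature.RepresentationTheory.SeesawScalar.twist`).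

This is the algebra behind «the oscillator representation depends only on the class of `ε`» /
the change of `(μ, χ)` under a central twist in [Liu2021, App. D §D.1]; nothing of [Liu2021, Lemma D.1] is asserted.
0 named facts, 0 hypothesis records: definitions + theorems only.

## References
* [GelbartRogawski1991] S. Gelbart, J. Rogawski, *L-functions and Fourier–Jacobi coefficients for the unitary group
  U(3)*, Invent. Math. 105 (1991), §3.1 Remark p. 457 (L4–13).
* [Liu2021] Y. Liu, *Fourier–Jacobi cycles and arithmetic relative trace formula*, Camb. J. Math. 9 (2021) =
  arXiv:2102.11518, App. D §D.1 (l. 5214–5233).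
-/

noncomputable section

namespace Literature.NumberTheory.GelbartRogawski1991.UnitaryDualPair.WeilCoinv

open Literature.NumberTheory.GelbartRogawski1991 Literature.NumberTheory.GelbartRogawski1991.UnitaryDualPair
open Literature.NumberTheory.Automorphic Literature.NumberTheory.Weil1964
open Literature.RepresentationTheory
open scoped Kronecker
open NumberField

variable (F E : Type) [Field F] [NumberField F] [Field E] [NumberField E] [Algebra F E]
variable (c : E ≃ₐ[F] E) (N M : ℕ) {n : ℕ} (e : Fin N × Fin M ≃ Fin n)
variable (JV : Matrix (Fin N) (Fin N) E) (JW : Matrix (Fin M) (Fin M) E)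
variable {TV : Matrix (Fin N) (Fin N) F} {TW : Matrix (Fin M) (Fin M) F}
variable [Algebra.IsQuadraticExtension F E] {δ : E} (hcδ : c δ = -δ) (hδ : δ ≠ 0) {d : F}
  (hd : δ * δ = algebraMap F E d) (hV : TV.IsSymm) (hW : TW.IsSymm) (hVd : IsUnit TV.det) (hWd : IsUnit TW.det)
  (hJV : JV = TV.map (algebraMap F E)) (hJW : JW = TW.map (algebraMap F E))
  {s : UnitaryGroup.adelicPair F E c N M JV JW →* adelicMpCont F (Fin n) (adelicGram F e TV TW)}

/-! ### §2b. Central twists of the splitting ([GelbartRogawski1991, Remark p. 457]) -/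

section Twist

open Literature.RepresentationTheory

variable (ĉ : UnitaryGroup.adelicPair F E c N M JV JW →* ℂˣ)

omit [Algebra.IsQuadraticExtension F E] in
/-- the `U(J_V)(𝔸_{F,f})`-part `k ↦ ĉ((1, k) ⊗ 1)` of a character of `G₁(𝔸_F) = U(J_V ⊗ J_W)(𝔸_F)`. [folklore] -/
def twistCharV : UnitaryGroup.finAdelic F E c N JV →* ℂˣ :=
  ĉ.comp ((UnitaryGroup.adelicInl F E c N M JV JW).comp (UnitaryGroup.finAdelicToAdelic F E c N JV))

omit [Algebra.IsQuadraticExtension F E] in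
/-- the `U(J_W)(𝔸_{F,f})`-part `u ↦ ĉ(1 ⊗ (1, u))`. [folklore] -/
def twistCharW : UnitaryGroup.finAdelic F E c M JW →* ℂˣ :=
  ĉ.comp ((UnitaryGroup.adelicInr F E c N M JV JW).comp (UnitaryGroup.finAdelicToAdelic F E c M JW))

omit [Algebra.IsQuadraticExtension F E] in
/-- `twistCharV ĉ k = ĉ ((1, k) ⊗ 1)` on elements. [cite: GelbartRogawski1991, §3.1 Remark p. 457 L4–13] -/
@[simp] theorem twistCharV_apply (k : UnitaryGroup.finAdelic F E c N JV) :
    twistCharV F E c N M JV JW ĉ k = ĉ (UnitaryGroup.adelicInl F E c N M JV JW (UnitaryGroup.finAdelicToAdelic F E c N JV k)) :=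
  rfl

omit [Algebra.IsQuadraticExtension F E] in
/-- `twistCharW ĉ u = ĉ (1 ⊗ (1, u))` on elements. [cite: GelbartRogawski1991, §3.1 Remark p. 457 L4–13] -/
@[simp] theorem twistCharW_apply (u : UnitaryGroup.finAdelic F E c M JW) :
    twistCharW F E c N M JV JW ĉ u = ĉ (UnitaryGroup.adelicInr F E c N M JV JW (UnitaryGroup.finAdelicToAdelic F E c M JW u)) :=
  rfl

/-- **An automorphic central twist keeps compatibility**: if `ĉ = 1` on `G₁(F)` then `s ⊗ ĉ` is compatible when
`s` is (vendored `IsCompatible.of_central_twist` with `ν := (1, ĉ·id)`, `π(1, c·id) = 1`).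
[cite: GelbartRogawski1991, §3.1 Remark p. 457 L4–13] -/
theorem isCompatible_twist (hs : (splittingDatum F E c N M e JV JW hcδ hδ hd hV hW hVd hWd hJV hJW).IsCompatible s)
    (hrat : ∀ γ ∈ (splittingDatum F E c N M e JV JW hcδ hδ hd hV hW hVd hWd hJV hJW).ratPts, ĉ γ = 1) :
    (splittingDatum F E c N M e JV JW hcδ hδ hd hV hW hVd hWd hJV hJW).IsCompatible
      (adelicMpCont.twist F (Fin n) (adelicGram F e TV TW) s ĉ) :=
  hs.of_central_twist (fun g => adelicMpCont.ofScalar F (Fin n) (adelicGram F e TV TW) (ĉ g))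
    (fun g => by simp only [splittingDatum_proj, adelicMpCont.proj_ofScalar])
    (fun g => adelicMpCont.twist_apply s ĉ g) fun γ hγ => by simp only [hrat γ hγ, map_one]

omit [Algebra.IsQuadraticExtension F E] in
/-- `(s ⊗ ĉ)_pair (x, y) = (1, ĉ(x ⊗ y)·id) · s_pair (x, y)`. [cite: GelbartRogawski1991, §3.1 Remark p. 457 L4–13] -/
theorem pairSplitting_twist_apply (p : UnitaryGroup.adelic F E c N JV × UnitaryGroup.adelic F E c M JW) :
    pairSplitting F E c N M e JV JW (adelicMpCont.twist F (Fin n) (adelicGram F e TV TW) s ĉ) p =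
      adelicMpCont.ofScalar F (Fin n) (adelicGram F e TV TW)
          (ĉ (UnitaryGroup.adelicInl F E c N M JV JW p.1 * UnitaryGroup.adelicInr F E c N M JV JW p.2)) *
        pairSplitting F E c N M e JV JW s p := by
  simp only [pairSplitting_apply, adelicMpCont.twist_apply]

omit [Algebra.IsQuadraticExtension F E] in
/-- **`ω_ψ ∘ (s ⊗ ĉ)_pair = ĉ_pair • ω_ψ ∘ s_pair`.** [cite: GelbartRogawski1991, §3.1 p. 454] -/
theorem pairRep_twist_apply (p : UnitaryGroup.adelic F E c N JV × UnitaryGroup.adelic F E c M JW)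
    (Φ : piSchwartzBruhat F (Fin n)) :
    pairRep F E c N M e JV JW (adelicMpCont.twist F (Fin n) (adelicGram F e TV TW) s ĉ) p Φ =
      ((ĉ (UnitaryGroup.adelicInl F E c N M JV JW p.1 * UnitaryGroup.adelicInr F E c N M JV JW p.2) : ℂˣ) : ℂ) •
        pairRep F E c N M e JV JW s p Φ := by
  simp only [pairRep_apply, pairSplitting_twist_apply, map_mul (adelicMpCont.omega F (Fin n) (adelicGram F e TV TW)),
    Module.End.mul_apply, adelicMpCont.omega_ofScalar]

omit [Algebra.IsQuadraticExtension F E] in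
/-- the same in the Kronecker currency of `pairSmall₁`. [cite: GelbartRogawski1991, §3.1 Remark p. 457 L4–13] -/
theorem omega_pairSmall₁_twist_apply (p : UnitaryGroup.adelic F E c N JV × UnitaryGroup.adelic F E c M JW)
    (Φ : piSchwartzBruhat F (Fin N × Fin M)) :
    adelicMpCont.omega F (Fin N × Fin M) _
        (pairSmall₁ F E c N M e JV JW (adelicMpCont.twist F (Fin n) (adelicGram F e TV TW) s ĉ) p) Φ =
      ((ĉ (UnitaryGroup.adelicInl F E c N M JV JW p.1 * UnitaryGroup.adelicInr F E c N M JV JW p.2) : ℂˣ) : ℂ) •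
        adelicMpCont.omega F (Fin N × Fin M) _ (pairSmall₁ F E c N M e JV JW s p) Φ := by
  simp only [omega_pairSmall₁_apply, pairRep_twist_apply, LinearEquiv.map_smul]

section FinTwist

open scoped SchwartzMap TensorProduct Classical
open NumberField.mixedEmbedding IsDedekindDomain

/-- **The finite Weil representation of a twisted splitting**:
`ω_f^{s ⊗ ĉ}(k, u) = ĉ((1,k) ⊗ 1) · ĉ(1 ⊗ (1,u)) • ω_f^{s}(k, u) = (twistCharV ĉ k · twistCharW ĉ u) • ω_f^{s}(k, u)`
(the finite factor is unique, `finRepMp_unique`, and `ω((s ⊗ ĉ)_pair(ι k, ι u)) (Φ_∞ ⊗ f) = Φ_∞ ⊗ (ĉ • ω_f^s(k,u) f)` by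
§2a). [cite: Weil1964, Chap. III n° 37–38 p. 188–190; GelbartRogawski1991, §3.1 Remark p. 457] -/
theorem finPairRep_twist (hs : (splittingDatum F E c N M e JV JW hcδ hδ hd hV hW hVd hWd hJV hJW).IsCompatible s)
    (hs' : (splittingDatum F E c N M e JV JW hcδ hδ hd hV hW hVd hWd hJV hJW).IsCompatible
      (adelicMpCont.twist F (Fin n) (adelicGram F e TV TW) s ĉ))
    (q : UnitaryGroup.finAdelic F E c N JV × UnitaryGroup.finAdelic F E c M JW) (f : FinSB F (Fin N × Fin M)) :
    finPairRep F E c N M e JV JW hcδ hδ hd hV hW hVd hWd hJV hJW hs' q f =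
      ((twistCharV F E c N M JV JW ĉ q.1 * twistCharW F E c N M JV JW ĉ q.2 : ℂˣ) : ℂ) •
        finPairRep F E c N M e JV JW hcδ hδ hd hV hW hVd hWd hJV hJW hs q f := by
  have hΦ₀ : unitSchwartz F (Fin N × Fin M) ≠ 0 := by
    intro h0
    have h1 := unitSchwartz_apply_zero (F := F) (ι := Fin N × Fin M)
    rw [h0] at h1
    simp at h1
  have hB : ∀ g : FinSB F (Fin N × Fin M),
      adelicMpCont.omega F (Fin N × Fin M) _
          (((pairSmall₁ F E c N M e JV JW (adelicMpCont.twist F (Fin n) (adelicGram F e TV TW) s ĉ)).comp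
            (finPairToAdelic F E c N M JV JW)) q)
          (piSchwartzBruhatEquiv F (Fin N × Fin M) (unitSchwartz F (Fin N × Fin M) ⊗ₜ[ℂ] g)) =
        piSchwartzBruhatEquiv F (Fin N × Fin M) (unitSchwartz F (Fin N × Fin M) ⊗ₜ[ℂ]
          ((((ĉ (UnitaryGroup.adelicInl F E c N M JV JW (finPairToAdelic F E c N M JV JW q).1 *
                UnitaryGroup.adelicInr F E c N M JV JW (finPairToAdelic F E c N M JV JW q).2) : ℂˣ) : ℂ) •
            finPairRep F E c N M e JV JW hcδ hδ hd hV hW hVd hWd hJV hJW hs q) g)) := fun g => by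
    simp only [MonoidHom.coe_comp, Function.comp_apply, omega_pairSmall₁_twist_apply,
      omega_pairSmall₁_finPairToAdelic_tmul F E c N M e JV JW hcδ hδ hd hV hW hVd hWd hJV hJW hs q, LinearMap.smul_apply,
      TensorProduct.tmul_smul, LinearEquiv.map_smul]
  have huniq := finRepMp_unique (isUnit_kronecker_map F N hVd hWd)
    ((pairSmall₁ F E c N M e JV JW (adelicMpCont.twist F (Fin n) (adelicGram F e TV TW) s ĉ)).comp
      (finPairToAdelic F E c N M JV JW))
    (fun p a w => proj_pairSmall₁_finAdelic_apply_archVec F E c N M e JV JW hcδ hδ hd hV hW hVd hWd hJV hJW hs'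
      p.1 p.2 a w) q hΦ₀ hB
  show finRepMp (isUnit_kronecker_map F N hVd hWd)
      ((pairSmall₁ F E c N M e JV JW (adelicMpCont.twist F (Fin n) (adelicGram F e TV TW) s ĉ)).comp
        (finPairToAdelic F E c N M JV JW))
      (fun p a w => proj_pairSmall₁_finAdelic_apply_archVec F E c N M e JV JW hcδ hδ hd hV hW hVd hWd hJV hJW hs'
        p.1 p.2 a w) q f = _
  rw [← huniq, LinearMap.smul_apply, map_mul ĉ]
  rfl

end FinTwist

/-- `U(J_V)`-member: `ω_f^{s ⊗ ĉ}(k, 1) = twistCharV ĉ k • ω_f^{s}(k, 1)`. [cite: GelbartRogawski1991, §3.1 Remark p. 457 L4–13] -/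
theorem finPairRepV_twist (hs : (splittingDatum F E c N M e JV JW hcδ hδ hd hV hW hVd hWd hJV hJW).IsCompatible s)
    (hs' : (splittingDatum F E c N M e JV JW hcδ hδ hd hV hW hVd hWd hJV hJW).IsCompatible
      (adelicMpCont.twist F (Fin n) (adelicGram F e TV TW) s ĉ))
    (k : UnitaryGroup.finAdelic F E c N JV) (f : FinSB F (Fin N × Fin M)) :
    finPairRepV F E c N M e JV JW hcδ hδ hd hV hW hVd hWd hJV hJW hs' k f =
      ((twistCharV F E c N M JV JW ĉ k : ℂˣ) : ℂ) • finPairRepV F E c N M e JV JW hcδ hδ hd hV hW hVd hWd hJV hJW hs k f := by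
  have h := finPairRep_twist F E c N M e JV JW hcδ hδ hd hV hW hVd hWd hJV hJW ĉ hs hs' (k, 1) f
  rw [map_one, mul_one] at h
  exact h

/-- `U(J_W)`-member: `ω_f^{s ⊗ ĉ}(1, u) = twistCharW ĉ u • ω_f^{s}(1, u)`. [cite: GelbartRogawski1991, §3.1 Remark p. 457 L4–13] -/
theorem finPairRepW_twist (hs : (splittingDatum F E c N M e JV JW hcδ hδ hd hV hW hVd hWd hJV hJW).IsCompatible s)
    (hs' : (splittingDatum F E c N M e JV JW hcδ hδ hd hV hW hVd hWd hJV hJW).IsCompatible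
      (adelicMpCont.twist F (Fin n) (adelicGram F e TV TW) s ĉ))
    (u : UnitaryGroup.finAdelic F E c M JW) (f : FinSB F (Fin N × Fin M)) :
    finPairRepW F E c N M e JV JW hcδ hδ hd hV hW hVd hWd hJV hJW hs' u f =
      ((twistCharW F E c N M JV JW ĉ u : ℂˣ) : ℂ) • finPairRepW F E c N M e JV JW hcδ hδ hd hV hW hVd hWd hJV hJW hs u f := by
  have h := finPairRep_twist F E c N M e JV JW hcδ hδ hd hV hW hVd hWd hJV hJW ĉ hs hs' (1, u) f
  rw [map_one, one_mul] at h
  exact h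

/-- **Equal relation submodules**: for `χ' = twistCharW ĉ · χ` (pointwise) the `χ'`-relations of `ω_f^{s ⊗ ĉ}` are the
`χ`-relations of `ω_f^{s}` (same submodule of `𝒮((𝔸_F^∞)^{NM})`). [cite: GelbartRogawski1991, §3.1 Remark p. 457 L4–13] -/
theorem ker_weilCoinv_twist (hs : (splittingDatum F E c N M e JV JW hcδ hδ hd hV hW hVd hWd hJV hJW).IsCompatible s)
    (hs' : (splittingDatum F E c N M e JV JW hcδ hδ hd hV hW hVd hWd hJV hJW).IsCompatible
      (adelicMpCont.twist F (Fin n) (adelicGram F e TV TW) s ĉ))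
    {χ χ' : UnitaryGroup.finAdelic F E c M JW →* ℂˣ} (hχ : ∀ u, χ' u = twistCharW F E c N M JV JW ĉ u * χ u) :
    TwistedCoinv.ker (finPairRepW F E c N M e JV JW hcδ hδ hd hV hW hVd hWd hJV hJW hs') χ' =
      TwistedCoinv.ker (finPairRepW F E c N M e JV JW hcδ hδ hd hV hW hVd hWd hJV hJW hs) χ :=
  TwistedCoinv.ker_eq_of_forall_smul (twistCharW F E c N M JV JW ĉ)
    (fun u f => finPairRepW_twist F E c N M e JV JW hcδ hδ hd hV hW hVd hWd hJV hJW ĉ hs hs' u f) hχ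

/-- **`Ω(s ⊗ ĉ, χ') ≃ Ω(s, χ)` as vector spaces** for `χ' = twistCharW ĉ · χ`: the two quotients of `𝒮((𝔸_F^∞)^{NM})` by
the SAME submodule (`Submodule.quotEquivOfEq`; `mk f ↦ mk f`). [folklore] -/
def weilCoinvTwistEquiv (hs : (splittingDatum F E c N M e JV JW hcδ hδ hd hV hW hVd hWd hJV hJW).IsCompatible s)
    (hs' : (splittingDatum F E c N M e JV JW hcδ hδ hd hV hW hVd hWd hJV hJW).IsCompatible
      (adelicMpCont.twist F (Fin n) (adelicGram F e TV TW) s ĉ))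
    {χ χ' : UnitaryGroup.finAdelic F E c M JW →* ℂˣ} (hχ : ∀ u, χ' u = twistCharW F E c N M JV JW ĉ u * χ u) :
    TwistedCoinv.Coinv (finPairRepW F E c N M e JV JW hcδ hδ hd hV hW hVd hWd hJV hJW hs') χ' ≃ₗ[ℂ]
      TwistedCoinv.Coinv (finPairRepW F E c N M e JV JW hcδ hδ hd hV hW hVd hWd hJV hJW hs) χ :=
  Submodule.quotEquivOfEq _ _ (ker_weilCoinv_twist F E c N M e JV JW hcδ hδ hd hV hW hVd hWd hJV hJW ĉ hs hs' hχ)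

variable (hs : (splittingDatum F E c N M e JV JW hcδ hδ hd hV hW hVd hWd hJV hJW).IsCompatible s)
  (hs' : (splittingDatum F E c N M e JV JW hcδ hδ hd hV hW hVd hWd hJV hJW).IsCompatible
    (adelicMpCont.twist F (Fin n) (adelicGram F e TV TW) s ĉ))
  {χ χ' : UnitaryGroup.finAdelic F E c M JW →* ℂˣ} (hχ : ∀ u, χ' u = twistCharW F E c N M JV JW ĉ u * χ u)

/-- `weilCoinvTwistEquiv (mk f) = mk f`. [cite: GelbartRogawski1991, §3.1 Remark p. 457 L4–13] -/
@[simp] theorem weilCoinvTwistEquiv_mk (f : FinSB F (Fin N × Fin M)) :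
    weilCoinvTwistEquiv F E c N M e JV JW hcδ hδ hd hV hW hVd hWd hJV hJW ĉ hs hs' hχ
        (TwistedCoinv.mk (finPairRepW F E c N M e JV JW hcδ hδ hd hV hW hVd hWd hJV hJW hs') χ' f) =
      TwistedCoinv.mk (finPairRepW F E c N M e JV JW hcδ hδ hd hV hW hVd hWd hJV hJW hs) χ f := rfl

/-- `weilCoinvTwistEquiv.symm (mk f) = mk f`. [cite: GelbartRogawski1991, §3.1 Remark p. 457 L4–13] -/
@[simp] theorem weilCoinvTwistEquiv_symm_mk (f : FinSB F (Fin N × Fin M)) :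
    (weilCoinvTwistEquiv F E c N M e JV JW hcδ hδ hd hV hW hVd hWd hJV hJW ĉ hs hs' hχ).symm
        (TwistedCoinv.mk (finPairRepW F E c N M e JV JW hcδ hδ hd hV hW hVd hWd hJV hJW hs) χ f) =
      TwistedCoinv.mk (finPairRepW F E c N M e JV JW hcδ hδ hd hV hW hVd hWd hJV hJW hs') χ' f := rfl

/-- **The intertwining law**: `E (Ω(s ⊗ ĉ, χ')(k) x) = twistCharV ĉ k • Ω(s, χ)(k) (E x)` — under `E`, `Ω(s ⊗ ĉ, χ')` is
`Ω(s, χ)` with the `U(J_V)(𝔸_{F,f})`-action twisted by `twistCharV ĉ`. [cite: GelbartRogawski1991, §3.1 Remark p. 457] -/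
theorem weilCoinvTwistEquiv_weilCoinv (k : UnitaryGroup.finAdelic F E c N JV)
    (x : TwistedCoinv.Coinv (finPairRepW F E c N M e JV JW hcδ hδ hd hV hW hVd hWd hJV hJW hs') χ') :
    weilCoinvTwistEquiv F E c N M e JV JW hcδ hδ hd hV hW hVd hWd hJV hJW ĉ hs hs' hχ
        (weilCoinv F E c N M e JV JW hcδ hδ hd hV hW hVd hWd hJV hJW χ' hs' k x) =
      ((twistCharV F E c N M JV JW ĉ k : ℂˣ) : ℂ) •
        weilCoinv F E c N M e JV JW hcδ hδ hd hV hW hVd hWd hJV hJW χ hs k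
          (weilCoinvTwistEquiv F E c N M e JV JW hcδ hδ hd hV hW hVd hWd hJV hJW ĉ hs hs' hχ x) := by
  obtain ⟨f, rfl⟩ := TwistedCoinv.mk_surjective _ χ' x
  have h := finPairRep_twist F E c N M e JV JW hcδ hδ hd hV hW hVd hWd hJV hJW ĉ hs hs' (k, 1) f
  rw [map_one, mul_one] at h
  simp only [weilCoinv_mk, weilCoinvTwistEquiv_mk, h, map_smul]

/-- the same in `SeesawScalar.twist` currency: `E ∘ Ω(s ⊗ ĉ, χ')(k) = twist (twistCharV ĉ) (Ω(s, χ)) k ∘ E`. [cite: GelbartRogawski1991, §3.1 Remark p. 457 L4–13] -/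
theorem weilCoinvTwistEquiv_weilCoinv_eq_twist (k : UnitaryGroup.finAdelic F E c N JV)
    (x : TwistedCoinv.Coinv (finPairRepW F E c N M e JV JW hcδ hδ hd hV hW hVd hWd hJV hJW hs') χ') :
    weilCoinvTwistEquiv F E c N M e JV JW hcδ hδ hd hV hW hVd hWd hJV hJW ĉ hs hs' hχ
        (weilCoinv F E c N M e JV JW hcδ hδ hd hV hW hVd hWd hJV hJW χ' hs' k x) =
      SeesawScalar.twist (twistCharV F E c N M JV JW ĉ) (weilCoinv F E c N M e JV JW hcδ hδ hd hV hW hVd hWd hJV hJW χ hs) k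
        (weilCoinvTwistEquiv F E c N M e JV JW hcδ hδ hd hV hW hVd hWd hJV hJW ĉ hs hs' hχ x) :=
  (weilCoinvTwistEquiv_weilCoinv F E c N M e JV JW hcδ hδ hd hV hW hVd hWd hJV hJW ĉ hs hs' hχ k x).trans
    (SeesawScalar.twist_apply _ _ _ _).symm

end Twist

/-! ### Build-lane note (ops-buildfix G11b-3 recipe, LEDGER B13-1, 2026-08-21)
`lean -o` (the hub build lane, never `lean`/the gate check) runs Lean 4.32's library-suggestion indexers
(`Lean.LibrarySuggestions.SymbolFrequency` / `SineQuaNon`, from their `exportEntriesFn`) over the statement of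
every local theorem that is not a denied premise; on this family's statements (very large dependent binder
telescopes through the theta-kernel / dual-pair data) that fold runs for tens of minutes to hours and the build
lane kills the job (incident G11b-3, run/shared/lean/ops/buildfix/G11b-3-DOSSIER.md). `isDeniedPremise` skips
`[implicit_reducible]` constants before any fold, and a reducibility status on a *theorem* is inert (Meta never
unfolds `thmInfo`; the kernel ignores the attribute), so the public theorems of this file are tagged
`[implicit_reducible]` purely to keep them out of that index. Only other effect: they are not offered by
`+suggestions` premise selectors. No statement or proof is changed; superseded if the operator lands a
deny-list form (`HarnessLib.PremiseIndex`). -/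
set_option allowUnsafeReducibility true in
attribute [implicit_reducible]
  twistCharV_apply twistCharW_apply isCompatible_twist pairSplitting_twist_apply
  pairRep_twist_apply omega_pairSmall₁_twist_apply finPairRep_twist finPairRepV_twist
  finPairRepW_twist ker_weilCoinv_twist weilCoinvTwistEquiv_mk weilCoinvTwistEquiv_symm_mk
  weilCoinvTwistEquiv_weilCoinv weilCoinvTwistEquiv_weilCoinv_eq_twist

end Literature.NumberTheory.GelbartRogawski1991.UnitaryDualPair.WeilCoinv

/- build-lane note, addendum (ops-buildfix B14-5, 2026-08-22): local theorem constants the `[implicit_reducible]` block above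
cannot reach — auto-realized `*.congr_simp` lemmas, structure projections / `mk.inj` / `sizeOf_spec` — are still walked by the
`.olean` exporter's premise indexers (in-file census: FOLDED = 5, proxy 1.1e+11). A global `attribute` on a realized constant lands
on an async environment branch the exporter does not consult; this file-final, top-level `local` entry goes through the
synchronous scoped extension that `getReducibilityStatusCore` reads first and is never popped before export. It is not
exported and changes no statement or proof. -/
set_option allowUnsafeReducibility true in
attribute [local implicit_reducible]
  Literature.NumberTheory.GelbartRogawski1991.UnitaryDualPair.WeilCoinv.weilCoinvTwistEquiv.congr_simp
  Literature.NumberTheory.GelbartRogawski1991.UnitaryDualPair.WeilCoinv.finPairRep.congr_simp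
  Literature.NumberTheory.GelbartRogawski1991.UnitaryDualPair.splittingDatum.congr_simp
  Literature.NumberTheory.GelbartRogawski1991.UnitaryDualPair.WeilCoinv.finPairToAdelic.congr_simp
  Literature.NumberTheory.GelbartRogawski1991.UnitaryDualPair.WeilCoinv.twistCharV.congr_simp
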